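import Summits.QuantumFields.YangMills.Theorems.FluctuationComparisonRegPrIntLS2BetaKPLogRep

/-!
# KPL-E · the pinned (per-bond) criterion for a Kotecký–Preiss gas of bond polymers, and the one-stop door criterion ⇒ polymer representation

Cell `ym3-torus` (rung R3 = continuum SU(2) Yang–Mills on `T³`; NOT `d = 4`, NOT infinite volume, NOT a mass gap, NOT the
Clay problem), crux `stmt-QuantumFields-20520`, LINES g19-1 `largefield_gas.lean` v3 (organ LFG `LargeFieldGasRepCan`) and g19-2
`loop_ledger.lean` v6 (gas doors GAS `BeyondOneLoopGasCan` ∕ GAS₁ `LoopLedgerDepthOneGasCan`): both organs must DISCHARGE the Kotecký–Preiss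
inequality of the format `KPGasOn`,

  `∀ X, Σ_{X' : polyInc X' X} w̄(X') · e^{a(X') + κ ℓ(X')} ≤ a(X)`  with `a ≥ 0` and the pinned size `a{e} ≤ N`,

from what print gives, which is a PER-BOND PINNED SUM ([Balaban1989LargeFieldII] (1.97)∕(1.100): `|𝐑′(X)| ≤ e^{−p₀(g_k)} e^{−κ d_k(X)}`
summed over the domains `X ∋` a fixed block; [Rivasseau1991] (III.1.19) «`Σ_{Y ∋ 0} |A(Y)| e^{|Y|} < 1`»).  This file is the bond-polymer twin of the
tree's cube-polymer `PolymerBoundMayer.kp_of_criterion`: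

* `sum_polyInc_le_sum_mem` — the polymers incompatible with `X` (equal or overlapping) are counted through the bonds of `X`;
* **`kp_of_pinned_criterion`** — if `Σ_{X' ∋ e} w̄(X') e^{τ|X'| + κℓ(X')} ≤ τ` at every bond `e` (`w̄ ≥ 0`, `w̄(∅) = 0`), then the `KPGasOn` inequality holds
  with the size function `a(X) := τ·|X|` (so `a{e} = τ`);
* **`polymerRep_of_pinned_criterion`** — the one-stop door: V-local real activities dominated on the window by such a `w̄` represent
  `U ↦ log Re Ξ(w_U)` as a V-local polymer representation of weighted norm `≤ τ` at rate `κ` (KPL-D `polymerRep_of_kpGas` with `a := τ|·|`).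

Everything is PROVED (0 sorry, no new definitions, no named facts); generic and gauge-free (any finite bond type, any field type `B → G`,
any `δ` with the triangle inequality).  HONEST: bookkeeping for the organs' pens; LFG, GAS₁, REP, S2β, crux 20520 NOT proved; nothing of
Bałaban's renormalisation group is asserted.

References: V. Rivasseau, *From Perturbative to Constructive Renormalization* (1991) §III.1 (III.1.19) [Rivasseau1991]; R. Kotecký,
D. Preiss, Comm. Math. Phys. 103 (1986) (1) [KoteckyPreiss1986]; T. Bałaban, Comm. Math. Phys. 122 (1989) (1.97), (1.100) [Balaban1989LargeFieldII].
-/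

noncomputable section

open Finset
open scoped BigOperators
open Literature.Probability.LatticeModels
open Summit.QuantumFields.YangMills.Theorems.FluctuationComparisonRegPrIntLS2BetaKPLogRep

namespace Summit.QuantumFields.YangMills.Theorems.FluctuationComparisonRegPrIntLS2BetaKPLCriterion

variable {B : Type*} [Fintype B] [DecidableEq B]

/-- **Incompatible polymers are counted through the bonds**: for `f ≥ 0` with `f ∅ = 0`,
`Σ_{X' : X' = X ∨ X' ∩ X ≠ ∅} f(X') ≤ Σ_{e ∈ X} Σ_{X' ∋ e} f(X')`. [cite: Rivasseau1991, §III.1 (III.1.19) and (III.1.43)] -/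
theorem sum_polyInc_le_sum_mem (f : Finset B → ℝ) (hf : ∀ X, 0 ≤ f X) (hf0 : f ∅ = 0) (X : Finset B) :
    ∑ X' ∈ Finset.univ.filter (fun X' => polyInc X' X), f X' ≤
      ∑ e ∈ X, ∑ X' ∈ Finset.univ.filter (fun X' : Finset B => e ∈ X'), f X' := by
  rcases X.eq_empty_or_nonempty with hX | hX
  · subst hX
    have hset : Finset.univ.filter (fun X' : Finset B => polyInc X' ∅) = {∅} := by
      ext X'
      simp only [Finset.mem_filter, Finset.mem_univ, true_and, Finset.mem_singleton, polyInc,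
        Finset.inter_empty, Finset.not_nonempty_empty, or_false]
    rw [hset, Finset.sum_singleton, hf0, Finset.sum_empty]
  · have hsub : Finset.univ.filter (fun X' => polyInc X' X) ⊆
        X.biUnion fun e => Finset.univ.filter (fun X' : Finset B => e ∈ X') := by
      intro X' hX'
      have h := (Finset.mem_filter.1 hX').2
      have hne : (X' ∩ X).Nonempty := by
        rcases h with hEq | hne
        · rw [hEq, Finset.inter_self]; exact hX
        · exact hne
      obtain ⟨e, he⟩ := hne
      rw [Finset.mem_inter] at he
      exact Finset.mem_biUnion.2 ⟨e, he.2, Finset.mem_filter.2 ⟨Finset.mem_univ _, he.1⟩⟩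
    exact (Finset.sum_le_sum_of_subset_of_nonneg hsub fun X' _ _ => hf X').trans
      (sum_biUnion_le_sum_of_nonneg X _ f hf)

/-- **THE PINNED CRITERION ⇒ THE KOTECKÝ–PREISS INEQUALITY** (bond-polymer twin of `PolymerBoundMayer.kp_of_criterion`): if
`w̄ ≥ 0`, `w̄(∅) = 0` and at every bond `e` the pinned sum `Σ_{X' ∋ e} w̄(X') e^{τ|X'| + κℓ(X')} ≤ τ`, then for EVERY polymer `X`
`Σ_{X' : polyInc X' X} w̄(X') e^{τ|X'| + κℓ(X')} ≤ τ·|X|` — the `KPGasOn` inequality with `a(X) := τ|X|`.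
[cite: Rivasseau1991, §III.1 (III.1.19); KoteckyPreiss1986, (1)] -/
theorem kp_of_pinned_criterion (wbar ℓ : Finset B → ℝ) (κ τ : ℝ) (hw0 : ∀ X, 0 ≤ wbar X) (hwe : wbar ∅ = 0)
    (hcrit : ∀ e : B, ∑ X' ∈ Finset.univ.filter (fun X' : Finset B => e ∈ X'),
      wbar X' * Real.exp (τ * (X'.card : ℝ) + κ * ℓ X') ≤ τ) (X : Finset B) :
    ∑ X' ∈ Finset.univ.filter (fun X' => polyInc X' X),
        wbar X' * Real.exp (τ * (X'.card : ℝ) + κ * ℓ X') ≤ τ * (X.card : ℝ) := by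
  have hf : ∀ X', 0 ≤ wbar X' * Real.exp (τ * (X'.card : ℝ) + κ * ℓ X') := fun X' =>
    mul_nonneg (hw0 X') (Real.exp_nonneg _)
  have hf0 : wbar ∅ * Real.exp (τ * ((∅ : Finset B).card : ℝ) + κ * ℓ ∅) = 0 := by rw [hwe, zero_mul]
  refine (sum_polyInc_le_sum_mem _ hf hf0 X).trans ?_
  calc ∑ e ∈ X, ∑ X' ∈ Finset.univ.filter (fun X' : Finset B => e ∈ X'), wbar X' * Real.exp (τ * (X'.card : ℝ) + κ * ℓ X')
      ≤ ∑ _e ∈ X, τ := Finset.sum_le_sum fun e _ => hcrit e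
    _ = τ * (X.card : ℝ) := by rw [Finset.sum_const, nsmul_eq_mul, mul_comm]

/-- The criterion packaged as the three `a`-clauses of `KPGasOn` (`a ≥ 0`, the KP inequality, the pinned size `a{e} ≤ τ`).
[cite: KoteckyPreiss1986, (1); Rivasseau1991, §III.1 (III.1.19)] -/
theorem exists_size_of_pinned_criterion (wbar ℓ : Finset B → ℝ) (κ : ℝ) {τ : ℝ} (hτ : 0 ≤ τ) (hw0 : ∀ X, 0 ≤ wbar X)
    (hwe : wbar ∅ = 0)
    (hcrit : ∀ e : B, ∑ X' ∈ Finset.univ.filter (fun X' : Finset B => e ∈ X'),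
      wbar X' * Real.exp (τ * (X'.card : ℝ) + κ * ℓ X') ≤ τ) :
    ∃ a : Finset B → ℝ, (∀ X, 0 ≤ a X) ∧
      (∀ X : Finset B, ∑ X' ∈ Finset.univ.filter (fun X' => polyInc X' X),
          wbar X' * Real.exp (a X' + κ * ℓ X') ≤ a X) ∧
      (∀ e : B, a {e} ≤ τ) := by
  refine ⟨fun X => τ * (X.card : ℝ), fun X => mul_nonneg hτ (Nat.cast_nonneg _),
    fun X => kp_of_pinned_criterion wbar ℓ κ τ hw0 hwe hcrit X, fun e => ?_⟩
  simp

/-- **THE ONE-STOP DOOR: pinned criterion ⇒ V-local polymer representation with field-uniform weights.**  Fields `U : B → G`, a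
«distance» `δ` with the triangle inequality, real V-local activities `w_U` dominated on the window `W` by `w̄ ≥ 0` (`w̄ ∅ = 0`), lengths
`ℓ(X) ≥ 0` dominating the `δ`-diameter of `X`, `κ ≥ 0`, `τ ≥ 0`, and the pinned criterion `Σ_{X' ∋ e} w̄(X') e^{τ|X'| + κℓ(X')} ≤ τ`
at every bond: then `U ↦ log Re Ξ(w_U)` is `c + Σ_i act_i(U)` on `W` with V-local `act_i`, field-uniform weights, diameters `≤ len_i`
and `Σ_{i : e ∈ supp_i} wt_i e^{κ len_i} ≤ τ`. [cite: Balaban1989LargeFieldII, (1.97)-(1.100) p.389-390; KoteckyPreiss1986, Theorem p.492 (2),(4); Rivasseau1991, §III.1 (III.1.19)] -/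
theorem polymerRep_of_pinned_criterion {G : Type*} (δ : B → B → ℝ) (hδ : ∀ x y z, δ x z ≤ δ x y + δ y z)
    (W : Set (B → G)) {κ τ : ℝ} (hκ : 0 ≤ κ) (hτ : 0 ≤ τ)
    (w : (B → G) → Finset B → ℝ) (wbar ℓ : Finset B → ℝ)
    (hloc : ∀ (X : Finset B) (U U' : B → G), (∀ e ∈ X, U e = U' e) → w U X = w U' X)
    (hw0 : ∀ X, 0 ≤ wbar X) (hwe : wbar ∅ = 0) (hℓ : ∀ X, 0 ≤ ℓ X)
    (hdom : ∀ U, U ∈ W → ∀ X, |w U X| ≤ wbar X)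
    (hdiam : ∀ X : Finset B, ∀ e ∈ X, ∀ e' ∈ X, δ e e' ≤ ℓ X)
    (hcrit : ∀ e : B, ∑ X' ∈ Finset.univ.filter (fun X' : Finset B => e ∈ X'),
      wbar X' * Real.exp (τ * (X'.card : ℝ) + κ * ℓ X') ≤ τ) :
    ∃ (n : ℕ) (supp : Fin n → Finset B) (len wt : Fin n → ℝ) (act : Fin n → (B → G) → ℝ) (c : ℝ),
      (∀ i (U U' : B → G), (∀ e ∈ supp i, U e = U' e) → act i U = act i U') ∧ (∀ i, 0 ≤ wt i) ∧
      (∀ i, ∀ e ∈ supp i, ∀ e' ∈ supp i, δ e e' ≤ len i) ∧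
      (∀ i U, U ∈ W → |act i U| ≤ wt i) ∧
      (∀ e : B, ∑ i ∈ Finset.univ.filter (fun i => e ∈ supp i), wt i * Real.exp (κ * len i) ≤ τ) ∧
      ∀ U, U ∈ W → Real.log (polymerPartitionFunction polyInc (fun X : Finset B => ((w U X : ℝ) : ℂ)) Finset.univ).re =
        c + ∑ i, act i U := by
  obtain ⟨a, ha, hKP, hpin⟩ := exists_size_of_pinned_criterion wbar ℓ κ hτ hw0 hwe hcrit
  exact polymerRep_of_kpGas δ hδ W τ hκ w wbar a ℓ hloc ha hℓ hdom hdiam hKP hpin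

end Summit.QuantumFields.YangMills.Theorems.FluctuationComparisonRegPrIntLS2BetaKPLCriterion

end
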